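import Mathlib
import HarnessLib
import HarnessLib.Audit
import Summits.Langlands.Statement
import Summits.Langlands.Langlands.Theses.SchurDefectSplit
import Summits.Langlands.Langlands.Theorems.SchurDefectSplit
import Literature.NumberTheory.Automorphic.ACCAutomorphyLiftingCrystalline
import Literature.NumberTheory.Automorphic.Qian2022PotentialAutomorphy
import Literature.NumberTheory.Automorphic.EssConjSelfDual
import Literature.NumberTheory.GaloisRepresentations.ExtendedAdequateSubgroup
import Literature.NumberTheory.GaloisRepresentations.AbsGaloisOuterConj

/-!
# Schur-parity split of SCH (lens-5 g15) — `SchurDefectSplit.SchurDefectLayerLifting` ⟺ DYADIC cell ∧ ODD cell EXACTLY,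
# plus the typed engine T⁺ «Thorne 2017 Thm 5.1 with NEAR adequacy» (certified in print at ℓ = 2)

Decomposition node of the Langlands root ladder (cell decomp-langlands, lens 5 «finite/base range + asymptotic regime +
bridge», gen 15; RESIDUAL MODE, BLOCKER FIRST).  TARGET = SCH `Summit.Langlands.Langlands.Theses.SchurDefectSplit.SchurDefectLayerLifting`
(stmt-Langlands-27235, crux r2, leaf ATTACKABLE, of route-Langlands-SchurDefectSplit rev 0 @e184b167dace — lens-5 g14; lineage
`_root_.Langlands` → … → F† CoreAdequacySplit (g11) → DEG LieDefectSplit (g12) → CORE/CORE′ ExtendedAdequacySplit (g13) → SCH ∧ LDF (g14)).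
SCH = the tail instances (ℓ < 2(n+1), ℓ ≤ n, CycIrr, no adequate / solvably-adequate / quasi-adequate / extended-adequate layer, no
solvable-descent shadow, core-irreducible, not a functorial product, ¬SolvablyReducible, ¬SolvablyMated) carrying a LINEARLY ADEQUATE layer J
above the perfect core (Hom(J,k) = 0 ∧ H¹(J, ad) = 0 ∧ semisimpleSpan J = ⊤) ⇒ LiftTail.  Its rows of record (census I-L5g11–13, instrument
g14): (n, ℓ) = (3, 3) projective A₆ = Ω₃(9) × 4 (Valentiner), (4, 2) SL₂(4) ≅ A₅ on the Steinberg module / S₅ over it × 2.  The critic's standing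
question on SCH (rows 253/254, q2′) was: CERTIFY the engine claim T⁺ «Thorne, Math. Z. 285 (2017) Thm 5.1 survives weakening Def 2.20
(H¹(H, ad/Z) = 0) to linear adequacy (H¹(H, ad) = 0)» from a formula-bearing source, else SCH drops to IDEA-NEEDED.

## The finding (print, this generation)

Boxer–Calegari–Gee–Pilloni, *Modularity theorems for abelian surfaces* (arXiv:2502.20645, Feb 2025) [corpus:paper:arxiv-2502.20645]:
* Def 293/294 (p. 84): H ⊂ GL(V), V over k ⊂ 𝔽̄₂, is **nearly adequate** iff it is weakly adequate (Lemma 292: End(V) spanned by the semisimple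
  elements of H ⟺ the eigen-projection condition on every simple submodule of ad ⊗ k̄) AND H¹(H, k) = 0 AND H¹(H, ad) = 0 — symbol for symbol
  the route's linear-adequacy triple LIN (tree `ExtAdequacy.Schur.IsLinearlyAdequate`);
* Rem 295 (p. 84): «the only difference with [Thorne 2017, Def 2.20] is that H¹(H, ad) = 0 replaces H¹(H, ad/k) = 0 … the arguments of
  [Thorne 2017] apply unchanged» — Lemma 298 (immortal scalar classes) and Prop 299 (pp. 87–89: existence of Taylor–Wiles primes under NEAR
  adequacy, p = 2) are the re-proved Prop 2.21;
* Thm 315 (p. 93): an ORDINARY automorphy lifting theorem for U(n) at p = 2 with nearly adequate residual image INCLUDING Ihara avoidance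
  (Taylor's χ_v trick: any finite set T ⊇ ram(π) ∪ S₂; (R^{T,ord})^red = 𝕋^{T,ord}_𝔪), F CM, F/F⁺ unramified, 2 split, π ordinary RACSDC,
  n[F⁺:ℚ] ≡ 0 mod 4, a regular semisimple element in the image, and for n even a strongly residually odd infinite place;
* Lemma 379 / Rem 380 (p. 122): A₅ ≅ SL₂(4) on V = U ⊗ U^σ (the 4-dimensional STEINBERG module over 𝔽̄₂) is NEARLY ADEQUATE and NOT adequate
  in Thorne's sense (H¹(A₅, ad/k) ≅ H²(A₅, k) ≅ k) — i.e. EXACTLY the route's (4, 2) rows of record, decided in print the same way instrument g14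
  decided them (span 16/16, H¹(ad) = 0, H¹(ad/Z) = 1); Lemmas 381/382: strong residual oddness for A₅(b) ⊂ GSp₄(𝔽₂) when ρ̄(c_v) ≠ 1;
* pp. 3–4 + Thm 1: via the 2–3 switch, abelian surfaces B/ℚ with ρ̄_{B,2}(G_ℚ) ≅ S₅, A₅ over a real quadratic F⁺, are proved modular with this
  machinery («modularity lifting theorems which apply when p = 2 and the residual image is rather small») — a RUNG IN PRINT for the dyadic cell.
* SECOND PRINT CERTIFICATE (independent authors): Tsuzuki–Yamauchi(?) arXiv:2506.23938 (2025, «The residual monodromy for the Dwork family in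
  even characteristic …») Thm 5.4 (p. 19: «an extension of the even dimensional case of [Thorne 2017]. The only difference is that condition
  “adequate” was changed to “nearly adequate” … the argument in [Th2] go through verbatim», minimal / level prime to 2, 2n-dimensional, strongly
  residually odd) and Thm 5.5 / Thm 1.2 (pp. 3–4, 20: POTENTIALLY DIAGONALIZABLE at v ∣ 2 — beyond the minimal/ordinary frame — for
  ρ : G_{F⁺} → GSp_{2n}(ℚ̄₂) with ρ̄(G_F) nearly adequate), applied to the Dwork quintic family [corpus:paper:arxiv-2506.23938 p3–4, p19–20].
So: T⁺ is CERTIFIED IN PRINT AT ℓ = 2 (and there with Ihara avoidance in the ordinary sector, lifting g14's «minimal type only» placement of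
`PatchingLocalComponentBarrier` at the dyadic prime); at ODD ℓ it remains a referee-grade remark (Thorne's Thm 5.1 is stated for all p; BCGP
re-prove only the p = 2 case they need; the three places Prop 2.21 reads the image — (a) ρ̄(G_{F(ζ_{p^N})}) = ρ̄(G_{F(ζ_p)}) ⟸ Hom(H, 𝔽_p) = 0,
(b) the eigen-condition ⟸ weak adequacy, (c) inflation–restriction with coefficients in the FULL ad ⟸ H¹(H, ad) = 0 — are prime-uniform, and
Lemmas 2.17–2.19 use absolute irreducibility only; nobody has printed the sentence for odd p).

## The node (lens-true: base range = the dyadic prime, generic regime = odd primes, bridge = the typed prime-uniform engine)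

SCH ⟺ D ∧ O EXACTLY (`sch_iff_cells`, one `Decidable (ℓ = 2)` case split on the cell's own bound prime; `closes : D → O → SCH` BY NAME):
* D `DyadicSchurLayerLifting` (crux 2, WEAKER than SCH — `Cert.d_of_sch`, no D → SCH: kit probes / bc7 P5 — ATTACKABLE NOW): SCH at ℓ = 2.
  Rows of record (4, 2) × 2 = BCGP Lemma 379 verbatim; engine in print ×2 (BCGP Thm 315 ordinary + Ihara avoidance; Thorne Thm 5.1 minimal,
  with (v)); rung in print (BCGP's A₅/S₅ abelian surfaces); transverse darkness booked honestly: D's rows sit in the EVEN-rank sector where strong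
  residual oddness (Thorne Def 3.3 / BCGP Def 314 — NOT typed in the tree: definition request) is needed, polarisation (unitary type), F CM.
* O `OddSchurLayerLifting` (residual 3, WEAKER than SCH — `Cert.o_of_sch` — DECLARED RESIDUAL): SCH at odd ℓ.  Rows of record (3, 3) Valentiner
  × 4; engine = T⁺ at odd p = referee-grade (no print sentence); the (3, 3) box additionally meets p = n = 3 with ζ₃ ∈ K(ζ₃) — exactly Thorne's
  «slight improvement … even when F contains a p-th root of unity» sector.
* T⁺ `NearlyAdequateOrdinaryMinimalLifting` (support 9, TYPED HERE for the first time, in-cone as the named stub `stub_Tplus` of O's birth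
  skeleton): the tree's NAMED FACT `Literature.NumberTheory.Automorphic.Thorne2017.automorphyLifting_unitary_ordinaryMinimal 𝓐` (Thm 5.1, minimal
  crystalline-ordinary case, ¬(p = 2 ∧ n even)) with hypothesis (ii) `Subgroup.IsThorne2017Adequate (τ(Γ_{F(ζ_p)}))` REPLACED by the near-adequacy
  triple on the same subgroup, universally quantified over CANONICAL local Artin data 𝓐 (`LocalArtinData.IsCanonical`, so that «ordinary of
  labelled weight» is read against THE Artin map).  Status: p = 2 ∧ n odd — THEOREM IN PRINT (BCGP Rem 295 + Prop 299 on Thorne's proof;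
  vendorable as a Literature named fact citing arXiv:2502.20645 Rem 295 / Thm 315); p odd — conjecture-let of referee grade (route item, never a
  Literature fact: THE MODEL, conjectures live in Theses).  T⁺ is NOT implied by `_root_.Langlands` (it is an R = T-type statement with its own
  hypotheses) and is not weaker than SCH: it is the ENGINE, filed as support so that provers of O (and of D, n odd) have the exact sentence to
  discharge or cite.
No further adequacy dial is introduced (critic q3′/e4/j2 honoured: the cut is by the residual characteristic, keyed on a PRINT CERTIFICATE that
exists at exactly one prime, and the new item is the engine landing the critic asked for, typed).

## Contents
§1 engine T⁺ (structured, by name over `Schur.IsLinearlyAdequate`) · §2 cells D, O (structured over the landed g11–g14 dials BY NAME) · §3 kernel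
`sch_iff_cells`, `sch_route_iff_cells` · §4 `closes` (→ SCH by name), `closes_coreN` (→ CORE′ via `SchurDefectSplit.closes`), `closes_core`
(→ CORE 26842 via `Schur.closes_core`) · §5 `Cert`: D, O ⟸ SCH ⟸ CORE′ ⟸ Langlands (necessity), engine bookkeeping · §6 inline mirror
`Summit.Langlands.Langlands.Theorems.SchurParityInline` = the route items VERBATIM with `Iff.rfl` bridges.  0 sorry; axioms standard.
-/

set_option linter.dupNamespace false

noncomputable section

namespace Summit.Langlands.Langlands.Theorems.CoreAdequacy.ExtAdequacy.SchurParity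

open scoped MatrixGroups NumberField
open Filter NumberField IsDedekindDomain Field
open Literature.NumberTheory.GaloisRepresentations Literature.NumberTheory.PAdicHodge Literature.NumberTheory.Automorphic
open Summit.Langlands.Langlands.Theses

/-! ## §1 The engine T⁺ — Thorne 2017 Thm 5.1 with NEAR adequacy (BCGP 2025 Def 294 / Rem 295) -/

/-- **T⁺(𝓐) — near-adequate twin of the tree fact `Thorne2017.automorphyLifting_unitary_ordinaryMinimal 𝓐`** (Thorne, Math. Z. 285 (2017)
Thm 5.1, minimal crystalline-ordinary case, `¬(p = 2 ∧ n even)`), with hypothesis (ii) «`ρ̄(Γ_{F(ζ_p)})` adequate in the sense of Def 2.20»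
(`Subgroup.IsThorne2017Adequate`: Hom(H,k) = 0 ∧ H¹(H, ad/Z) = 0 ∧ eigen-condition) REPLACED by NEAR ADEQUACY of the same subgroup
(`Schur.IsLinearlyAdequate`: Hom(H,k) = 0 ∧ H¹(H, ad) = 0 ∧ semisimpleSpan H = ⊤ — Boxer–Calegari–Gee–Pilloni arXiv:2502.20645 Def 293/294 with
Lemma 292 for «weakly adequate ⟺ span»).  Every other binder is the tree fact's, symbol for symbol (F imaginary CM, c̃ a lift of complex
conjugation, (i) polarisation in trace form, (iii) a.e. unramified, (iv) π RACSDC with r ∼ r_ι(π) residually τ, minimal: unramified away from p,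
crystalline and ordinary of one labelled weight at v ∣ p relative to `𝓐 F v`; conclusion `Qian2022.IsAutomorphic ι ρ`).
STATUS: p = 2 (n odd here) — IN PRINT: BCGP Rem 295 «the arguments of [Thorne 2017] apply unchanged», Lemma 298 + Prop 299 (TW primes under near
adequacy) [corpus:paper:arxiv-2502.20645 p84, p87–89], and Thm 315 (p93, ordinary, with Ihara avoidance) is a stronger dyadic engine; for n EVEN at
p = 2 the near-adequate Thorne theorem (with strong residual oddness) is recorded as arXiv:2506.23938 Thm 5.4 and extended to potentially diagonalizable
local conditions in Thm 5.5 [corpus:paper:arxiv-2506.23938 p19–20]; p odd —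
NOT in print (referee-grade: Prop 2.21 reads the image only through Hom(H,𝔽_p) = 0, the eigen-condition and H¹ with coefficients in the full ad
[corpus:paper:doi-10-1007-s00209-016-1681-2 p2, p25]).  A conjecture-let at odd p, hence a ROUTE ITEM, not a Literature fact. -/
def NearlyAdequateOrdinaryMinimalLiftingFor
    (𝓐 : ∀ (K : Type) [Field K] [NumberField K] (v : HeightOneSpectrum (𝓞 K)),
      LocalArtinData (v.adicCompletion K)) : Prop :=
  ∀ (F : Type) [Field F] [NumberField F] [IsCMField F],
    ∀ (n : ℕ), 2 ≤ n →
    ∀ (p : ℕ) [Fact p.Prime], ¬ (p = 2 ∧ Even n) →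
    ∀ (hcpt : isCompact_glFiniteIntegralLevel n F) (ι : PadicAlgCl p ≃+* ℂ)
      (ρ : FramedGaloisRep F (PadicAlgCl p) n)
      (τ : absoluteGaloisGroup F →* GL (Fin n) (padicAlgClResidueField p))
      (π : CuspidalAutomorphicRepData n F hcpt) (r : FramedGaloisRep F (PadicAlgCl p) n)
      (c : absoluteGaloisGroup (maximalRealSubfield F)),
      absGaloisQuot (maximalRealSubfield F) F c = IsCMField.complexConj F →
      (∀ σ : absoluteGaloisGroup F,
        ((FramedGaloisRep.outerConj c ρ) σ).val.trace =
          ((Units.map (algebraMap ℤ_[p] (PadicAlgCl p)).toMonoidHom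
              (GaloisRep.cyclotomicCharacter F p σ) ^ (1 - (n : ℤ)) : (PadicAlgCl p)ˣ) : PadicAlgCl p) *
            (ρ σ⁻¹).val.trace) →
      ρ.IsResidualRepOf (RingHom.id _) τ →
      Schur.IsLinearlyAdequate ((absGaloisGroupAdjoinRootsOfUnity F p).map τ) →
      (∀ᶠ v : HeightOneSpectrum (𝓞 F) in cofinite, ρ.IsUnramifiedAt v) →
      π.1.IsRegularAlgebraic → π.1.IsEssConjSelfDual 1 →
      HarrisLanTaylorThorne2016.IsCompatible π.1 ι r → r.IsResidualRepOf (RingHom.id _) τ →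
      (∀ v : HeightOneSpectrum (𝓞 F), ((p : ℕ) : 𝓞 F) ∉ v.asIdeal →
        π.1.IsUnramifiedAt v ∧ ρ.IsUnramifiedAt v ∧ r.IsUnramifiedAt v) →
      (∀ (v : HeightOneSpectrum (𝓞 F)) (hv : ((p : ℕ) : 𝓞 F) ∈ v.asIdeal),
        (fontainePstAdicCompletion v p hv).IsCrystallineFramed (ρ.toLocal v) ∧
        (fontainePstAdicCompletion v p hv).IsCrystallineFramed (r.toLocal v) ∧
        ∃ wt : LabelledWeight (v.adicCompletion F) (PadicAlgCl p) n,
          ρ.IsOrdinaryOfLabelledWeightAt v (𝓐 F v) wt ∧ r.IsOrdinaryOfLabelledWeightAt v (𝓐 F v) wt) →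
      Qian2022.IsAutomorphic ι ρ

/-- **T⁺ — the route item** `NearlyAdequateOrdinaryMinimalLifting`: T⁺(𝓐) for every CANONICALLY NORMALISED family of local Artin data 𝓐
(`LocalArtinData.IsCanonical`: `(𝓐 K v).artin = canonicalArtin`, so that «ordinary of labelled weight relative to `𝓐 F v`» is Thorne's
ordinarity against THE Artin map; the tree fact leaves 𝓐 free as a parameter — Variant R of `LocalClassFieldTheory` — and every consumer
instantiates it).  Structured twin of the inline route item (`SchurParityInline.tplus_inline_iff`, `Iff.rfl`). -/
def NearlyAdequateOrdinaryMinimalLifting : Prop :=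
  ∀ (𝓐 : ∀ (K : Type) [Field K] [NumberField K] (v : HeightOneSpectrum (𝓞 K)), LocalArtinData (v.adicCompletion K)),
    (∀ (K : Type) [Field K] [NumberField K] (v : HeightOneSpectrum (𝓞 K)), (𝓐 K v).IsCanonical) →
    NearlyAdequateOrdinaryMinimalLiftingFor 𝓐

/-- Unfolding: the item is `∀ 𝓐 canonical, T⁺(𝓐)`. [bookkeeping] -/
theorem nearlyAdequateOrdinaryMinimalLifting_iff : NearlyAdequateOrdinaryMinimalLifting ↔
    ∀ (𝓐 : ∀ (K : Type) [Field K] [NumberField K] (v : HeightOneSpectrum (𝓞 K)), LocalArtinData (v.adicCompletion K)),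
      (∀ (K : Type) [Field K] [NumberField K] (v : HeightOneSpectrum (𝓞 K)), (𝓐 K v).IsCanonical) →
      NearlyAdequateOrdinaryMinimalLiftingFor 𝓐 :=
  Iff.rfl

/-! ## §2 The cells: SCH cut by the residual characteristic (ℓ = 2 ∣ ℓ ≠ 2) -/

/-- **D — `DyadicSchurLayerLifting`** (crux, rank 2; WEAKER than SCH: `Cert.d_of_sch`; ATTACKABLE NOW): the Schur-defect cell SCH at the DYADIC prime
ℓ = 2 (so 2 ≤ n < ∞, position (n, 2)).  Rows of record: (4, 2) SL₂(4) ≅ A₅ on the Steinberg module and S₅ over it × 2 = BCGP Lemma 379 / Rem 380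
(nearly adequate, not adequate: H¹(A₅, ad/k) ≅ H²(A₅, k) ≅ k).  Engine IN PRINT: BCGP Thm 315 (p93: U(n), p = 2, π ORDINARY, ρ̄(G_F) nearly adequate,
Ihara avoidance) and Thorne Thm 5.1 (minimal type, any residual image adequate in Def 2.20 — which D's rows are NOT; with near adequacy by Rem 295);
rung IN PRINT: the A₅/S₅ abelian surfaces of BCGP pp. 3–4 (2–3 switch) — ρ_{B,2}, n = 4, ℓ = 2 — are instances of D's image type proved automorphic;
second print certificate of the dyadic engine: arXiv:2506.23938 Thm 5.4 (near-adequate Thorne, even rank) / Thm 5.5 (potentially diagonalizable at 2).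
Transverse darkness (booked, not evaded): F must be CM and ρ polarised (unitary type: `TwistedEndoscopySelfDual`, `TaylorWilesNumericalCoincidence`),
n even needs a strongly residually odd place (Thorne Def 3.3 / BCGP Def 314 — untyped in the tree), π ordinary at 2 for Ihara avoidance, and LiftTail
asks for every Hodge type while 2-adic weight cycling is absent.  Structured over the landed dials BY NAME; inline twin `SchurParityInline.DyadicSchurLayerLifting`. -/
def DyadicSchurLayerLifting : Prop :=
  ∀ (K : Type) [Field K] [NumberField K] (n : ℕ) (hcpt : isCompact_glFiniteIntegralLevel n K), 0 < n → LiftBelow n →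
    ∀ (ℓ : ℕ) [Fact ℓ.Prime] (ι : PadicAlgCl ℓ ≃+* ℂ) (ρ : FramedGaloisRep K (PadicAlgCl ℓ) n), ℓ < 2 * (n + 1) → ℓ = 2 →
      CycIrr ρ → ¬ AdequateCyclotomicImage ρ → ¬ SolvablyAdequateImage ρ → ¬ LieDefect.SolvableDescentShadow ρ →
      ¬ LieDefect.SolvablyQuasiAdequateImage ρ → ℓ ≤ n → ¬ SolvablyExtAdequateImage ρ → CoreIrreducibleImage ρ →
      ¬ Product.SolvablyFunctorialProduct ρ → Schur.SolvablyLinAdequateImage ρ →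
      ¬ BrightMate.SolvablyReducible ρ → ¬ BrightMate.SolvablyMated ι ρ → LiftTail K n hcpt ℓ ι ρ

/-- **O — `OddSchurLayerLifting`** (residual, rank 3; WEAKER than SCH: `Cert.o_of_sch`; DECLARED RESIDUAL of this node): the Schur-defect cell SCH at an
ODD prime ℓ (3 ≤ ℓ ≤ n).  Rows of record: (3, 3) projective A₆ = Ω₃(9) (Valentiner) × 4 — linearly adequate by instrument g14, H¹(ad/Z) = 1.  Engine:
T⁺ (`NearlyAdequateOrdinaryMinimalLifting`) at odd p — referee-grade, no sentence in print (BCGP re-prove Thorne's Prop 2.21 under near adequacy only at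
p = 2; the argument is prime-uniform).  Dark beyond the engine exactly as SCH was (CM + polarised + minimal frame; K neither CM nor totally real has
no patching).  Structured BY NAME; inline twin `SchurParityInline.OddSchurLayerLifting`. -/
def OddSchurLayerLifting : Prop :=
  ∀ (K : Type) [Field K] [NumberField K] (n : ℕ) (hcpt : isCompact_glFiniteIntegralLevel n K), 0 < n → LiftBelow n →
    ∀ (ℓ : ℕ) [Fact ℓ.Prime] (ι : PadicAlgCl ℓ ≃+* ℂ) (ρ : FramedGaloisRep K (PadicAlgCl ℓ) n), ℓ < 2 * (n + 1) → ℓ ≠ 2 →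
      CycIrr ρ → ¬ AdequateCyclotomicImage ρ → ¬ SolvablyAdequateImage ρ → ¬ LieDefect.SolvableDescentShadow ρ →
      ¬ LieDefect.SolvablyQuasiAdequateImage ρ → ℓ ≤ n → ¬ SolvablyExtAdequateImage ρ → CoreIrreducibleImage ρ →
      ¬ Product.SolvablyFunctorialProduct ρ → Schur.SolvablyLinAdequateImage ρ →
      ¬ BrightMate.SolvablyReducible ρ → ¬ BrightMate.SolvablyMated ι ρ → LiftTail K n hcpt ℓ ι ρ

/-! ## §3 Kernel: SCH ⟺ D ∧ O (EXACT, modulo nothing) -/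

/-- The route decl SCH is, definitionally, the landed structured twin `Schur.SchurDefectLayerLifting`. [bookkeeping] -/
theorem sch_route_iff_twin : SchurDefectSplit.SchurDefectLayerLifting ↔ Schur.SchurDefectLayerLifting := Iff.rfl

/-- D ⟸ SCH (necessity of the dyadic cell: restrict SCH to ℓ = 2). -/
theorem d_of_schTwin (h : Schur.SchurDefectLayerLifting) : DyadicSchurLayerLifting :=
  fun K _ _ n hcpt hn ih ℓ _ ι ρ hlt _ => h K n hcpt hn ih ℓ ι ρ hlt

/-- O ⟸ SCH (necessity of the odd cell: restrict SCH to ℓ ≠ 2). -/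
theorem o_of_schTwin (h : Schur.SchurDefectLayerLifting) : OddSchurLayerLifting :=
  fun K _ _ n hcpt hn ih ℓ _ ι ρ hlt _ => h K n hcpt hn ih ℓ ι ρ hlt

/-- SCH ⟸ D ∧ O (sufficiency: one decidable case split `ℓ = 2 ∨ ℓ ≠ 2` on the cell's own bound prime; no other content). -/
theorem schTwin_of_cells (hD : DyadicSchurLayerLifting) (hO : OddSchurLayerLifting) : Schur.SchurDefectLayerLifting :=
  fun K _ _ n hcpt hn ih ℓ _ ι ρ hlt =>
    if h2 : ℓ = 2 then hD K n hcpt hn ih ℓ ι ρ hlt h2 else hO K n hcpt hn ih ℓ ι ρ hlt h2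

/-- **KERNEL.** `Schur.SchurDefectLayerLifting ↔ DyadicSchurLayerLifting ∧ OddSchurLayerLifting` — EXACT. -/
theorem sch_iff_cells : Schur.SchurDefectLayerLifting ↔ DyadicSchurLayerLifting ∧ OddSchurLayerLifting :=
  ⟨fun h => ⟨d_of_schTwin h, o_of_schTwin h⟩, fun h => schTwin_of_cells h.1 h.2⟩

/-- **KERNEL, route form.** The ROUTE decl SCH (stmt-Langlands-27235) ⟺ D ∧ O. -/
theorem sch_route_iff_cells : SchurDefectSplit.SchurDefectLayerLifting ↔ DyadicSchurLayerLifting ∧ OddSchurLayerLifting :=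
  sch_route_iff_twin.trans sch_iff_cells

/-- CORE′ (stmt-Langlands-27082) ⟺ D ∧ O ∧ LDF — the g14 kernel refined by one more case split. -/
theorem coreN_route_iff_cells3 : ExtendedAdequacySplit.CoreIrreducibleNonProductLifting ↔
    DyadicSchurLayerLifting ∧ OddSchurLayerLifting ∧ Schur.LinearDefectLifting := by
  rw [Schur.coreN_route_iff_cells, sch_iff_cells, and_assoc]

/-! ## §4 Deciding theorems -/

/-- **`closes`** — the child route's deciding theorem: D → O → SCH, concluding the HOST CRUX `SchurDefectSplit.SchurDefectLayerLifting` BY NAME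
(= kit `vr.glue.lean` verbatim). -/
theorem closes (hD : DyadicSchurLayerLifting) (hO : OddSchurLayerLifting) : SchurDefectSplit.SchurDefectLayerLifting := by
  intro K _ _ n hcpt hn ih ℓ _ ι ρ hlt
  by_cases h2 : ℓ = 2
  · exact hD K n hcpt hn ih ℓ ι ρ hlt h2
  · exact hO K n hcpt hn ih ℓ ι ρ hlt h2

/-- One level up: D → O → LDF → CORE′ (stmt-Langlands-27082), through the parent route's `SchurDefectSplit.closes`. -/
theorem closes_coreN (hD : DyadicSchurLayerLifting) (hO : OddSchurLayerLifting) (hL : SchurDefectSplit.LinearDefectLifting) :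
    ExtendedAdequacySplit.CoreIrreducibleNonProductLifting :=
  Summit.Langlands.Langlands.Theses.SchurDefectSplit.closes (closes hD hO) hL

/-- Two levels up: CPR → D → O → LDF → CORE (stmt-Langlands-26842), through the landed `Schur.closes_core`. -/
theorem closes_core (hP : ExtendedAdequacySplit.CoreIrreducibleProductLifting) (hD : DyadicSchurLayerLifting) (hO : OddSchurLayerLifting)
    (hL : SchurDefectSplit.LinearDefectLifting) : ExtendedAdequacySplit.CoreIrreducibleInadequateLifting :=
  Schur.closes_core hP (closes hD hO) hL

/-! ## §5 Certificates -/

namespace Cert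

/-- D ⟸ SCH (route decl). -/
theorem d_of_sch (h : SchurDefectSplit.SchurDefectLayerLifting) : DyadicSchurLayerLifting := d_of_schTwin (sch_route_iff_twin.1 h)

/-- O ⟸ SCH (route decl). -/
theorem o_of_sch (h : SchurDefectSplit.SchurDefectLayerLifting) : OddSchurLayerLifting := o_of_schTwin (sch_route_iff_twin.1 h)

/-- D ⟸ CORE′ (stmt-Langlands-27082). -/
theorem d_of_coreN (h : ExtendedAdequacySplit.CoreIrreducibleNonProductLifting) : DyadicSchurLayerLifting := d_of_schTwin (Schur.Cert.sch_of_coreN h)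

/-- O ⟸ CORE′ (stmt-Langlands-27082). -/
theorem o_of_coreN (h : ExtendedAdequacySplit.CoreIrreducibleNonProductLifting) : OddSchurLayerLifting := o_of_schTwin (Schur.Cert.sch_of_coreN h)

/-- NECESSITY: D ⟸ `_root_.Langlands` (so D is false only together with reciprocity). -/
theorem d_of_langlands (hS : _root_.Langlands) : DyadicSchurLayerLifting := d_of_schTwin (Schur.Cert.sch_of_langlands hS)

/-- NECESSITY: O ⟸ `_root_.Langlands`. -/
theorem o_of_langlands (hS : _root_.Langlands) : OddSchurLayerLifting := o_of_schTwin (Schur.Cert.sch_of_langlands hS)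

/-- EXACTNESS restated: nothing of SCH is lost by the cut. -/
theorem sch_of_cells (hD : DyadicSchurLayerLifting) (hO : OddSchurLayerLifting) : SchurDefectSplit.SchurDefectLayerLifting := closes hD hO

/-- Engine bookkeeping: the item instantiates at any canonical family of local Artin data. -/
theorem tplus_at (h : NearlyAdequateOrdinaryMinimalLifting)
    (𝓐 : ∀ (K : Type) [Field K] [NumberField K] (v : HeightOneSpectrum (𝓞 K)), LocalArtinData (v.adicCompletion K))
    (h𝓐 : ∀ (K : Type) [Field K] [NumberField K] (v : HeightOneSpectrum (𝓞 K)), (𝓐 K v).IsCanonical) :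
    NearlyAdequateOrdinaryMinimalLiftingFor 𝓐 :=
  h 𝓐 h𝓐

end Cert

end Summit.Langlands.Langlands.Theorems.CoreAdequacy.ExtAdequacy.SchurParity

end

/-! ## §6 Inline mirror — the route items VERBATIM (what `ledger route open` renders), with `Iff.rfl` bridges to §§1–2 -/

namespace Summit.Langlands.Langlands.Theorems.SchurParityInline

/-- Route item D (crux 2) verbatim = SCH's route text with the literal `ℓ = 2 →` inserted after `ℓ < 2 * (n + 1) →`. -/
def DyadicSchurLayerLifting : Prop :=
  ∀ (K : Type) [Field K] [NumberField K] (n : ℕ) (hcpt : Literature.NumberTheory.Automorphic.isCompact_glFiniteIntegralLevel n K), 0 < n → Summit.Langlands.Langlands.Theorems.CoreAdequacy.LiftBelow n → ∀ (ℓ : ℕ) [Fact ℓ.Prime] (ι : PadicAlgCl ℓ ≃+* ℂ) (ρ : Literature.NumberTheory.GaloisRepresentations.FramedGaloisRep K (PadicAlgCl ℓ) n), ℓ < 2 * (n + 1) → ℓ = 2 → Summit.Langlands.Langlands.Theorems.CoreAdequacy.CycIrr ρ → ¬ Summit.Langlands.Langlands.Theorems.CoreAdequacy.AdequateCyclotomicImage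 ρ → ¬ Summit.Langlands.Langlands.Theorems.CoreAdequacy.SolvablyAdequateImage ρ → ¬ Summit.Langlands.Langlands.Theorems.CoreAdequacy.LieDefect.SolvableDescentShadow ρ → ¬ Summit.Langlands.Langlands.Theorems.CoreAdequacy.LieDefect.SolvablyQuasiAdequateImage ρ → ℓ ≤ n → ¬ (∃ τ : Field.absoluteGaloisGroup (CyclotomicField ℓ K) →* Matrix.GeneralLinearGroup (Fin n) (Literature.NumberTheory.GaloisRepresentations.padicAlgClResidueField ℓ), (ρ.restrictField (CyclotomicField ℓ K)).IsReductionOf (RingHom.id (Literature.NumberTheory.GaloisRepresentations.padicAlgClResidueField ℓ)) τ ∧ Literature.NumberTheory.GaloisRepresentations.IsAbsIrreducible τ ∧ ∃ J : Subgroup (Matrix.GeneralLinearGroup (Fin n) (Literature.NumberTheory.GaloisRepresentations.padicAlgClResidueField ℓ)), Summit.Langlands.Langlands.Theorems.CoreAdequacy.LieDefect.AboveCore τ.range J ∧ J ≤ τ.range ∧ Literature.NumberTheory.GaloisRepresentations.IsAbsIrreducible J.subtype ∧ Literature.NumberTheory.GaloisRepresentations.Subgroup.IsExtendedAdequate J)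 → (∃ τ : Field.absoluteGaloisGroup (CyclotomicField ℓ K) →* Matrix.GeneralLinearGroup (Fin n) (Literature.NumberTheory.GaloisRepresentations.padicAlgClResidueField ℓ), (ρ.restrictField (CyclotomicField ℓ K)).IsReductionOf (RingHom.id (Literature.NumberTheory.GaloisRepresentations.padicAlgClResidueField ℓ)) τ ∧ Literature.NumberTheory.GaloisRepresentations.IsAbsIrreducible τ ∧ Literature.NumberTheory.GaloisRepresentations.IsAbsIrreducible (Summit.Langlands.Langlands.Theorems.CoreAdequacy.perfectCore τ.range).subtype) → ¬ (∃ (E : Type) (_ : Field E) (_ : NumberField E) (_ : Algebra K E), IsGalois K E ∧ IsSolvable (E ≃ₐ[K] E) ∧ ((∃ (σ : Literature.NumberTheory.GaloisRepresentations.FramedGaloisRep E (PadicAlgCl ℓ) 2) (χ : Literature.NumberTheory.GaloisRepresentations.FramedGaloisRep E (PadicAlgCl ℓ) 1), σ.toGaloisRep.IsIrreducible ∧ Summit.Langlands.Langlands.Theorems.CoreAdequacy.LieDefect.Geometric σ ∧ Summit.Langlands.Langlands.Theorems.CoreAdequacy.LieDefect.Geometric χ ∧ ∀ g : Field.absoluteGaloisGroup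 E, 2 * Literature.NumberTheory.GaloisRepresentations.FramedRep.trace (ρ.restrictField E) g = Literature.NumberTheory.GaloisRepresentations.FramedRep.trace χ g * (Literature.NumberTheory.GaloisRepresentations.FramedRep.trace σ g ^ 2 + Literature.NumberTheory.GaloisRepresentations.FramedRep.trace σ (g * g))) ∨ (∃ σ₁ σ₂ : Literature.NumberTheory.GaloisRepresentations.FramedGaloisRep E (PadicAlgCl ℓ) 2, σ₁.toGaloisRep.IsIrreducible ∧ σ₂.toGaloisRep.IsIrreducible ∧ Summit.Langlands.Langlands.Theorems.CoreAdequacy.LieDefect.Geometric σ₁ ∧ Summit.Langlands.Langlands.Theorems.CoreAdequacy.LieDefect.Geometric σ₂ ∧ ∀ g : Field.absoluteGaloisGroup E, Literature.NumberTheory.GaloisRepresentations.FramedRep.trace (ρ.restrictField E) g = Literature.NumberTheory.GaloisRepresentations.FramedRep.trace σ₁ g * Literature.NumberTheory.GaloisRepresentations.FramedRep.trace σ₂ g))) → (∃ τ : Field.absoluteGaloisGroup (CyclotomicField ℓ K) →* Matrix.GeneralLinearGroup (Fin n) (Literature.NumberTheory.GaloisRepresentations.padicAlgClResidueField ℓ),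 (ρ.restrictField (CyclotomicField ℓ K)).IsReductionOf (RingHom.id (Literature.NumberTheory.GaloisRepresentations.padicAlgClResidueField ℓ)) τ ∧ Literature.NumberTheory.GaloisRepresentations.IsAbsIrreducible τ ∧ ∃ J : Subgroup (Matrix.GeneralLinearGroup (Fin n) (Literature.NumberTheory.GaloisRepresentations.padicAlgClResidueField ℓ)), Summit.Langlands.Langlands.Theorems.CoreAdequacy.LieDefect.AboveCore τ.range J ∧ J ≤ τ.range ∧ Literature.NumberTheory.GaloisRepresentations.IsAbsIrreducible J.subtype ∧ (∀ f : Additive J →+ Literature.NumberTheory.GaloisRepresentations.padicAlgClResidueField ℓ, f = 0) ∧ groupCohomology.cocycles₁ (Rep.of (Literature.NumberTheory.GaloisRepresentations.Subgroup.adRep J)) ≤ groupCohomology.coboundaries₁ (Rep.of (Literature.NumberTheory.GaloisRepresentations.Subgroup.adRep J)) ∧ Literature.NumberTheory.GaloisRepresentations.Subgroup.semisimpleSpan J = ⊤) → ¬ Summit.Langlands.Langlands.Theorems.BrightMate.SolvablyReducible ρ → ¬ Summit.Langlands.Langlands.Theorems.BrightMate.SolvablyMated ι ρ → Summit.Langlands.Langlands.Theorems.CoreAdequacy.LiftTail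 K n hcpt ℓ ι ρ

/-- Route item O (residual 3) verbatim = SCH's route text with the literal `ℓ ≠ 2 →` inserted after `ℓ < 2 * (n + 1) →`. -/
def OddSchurLayerLifting : Prop :=
  ∀ (K : Type) [Field K] [NumberField K] (n : ℕ) (hcpt : Literature.NumberTheory.Automorphic.isCompact_glFiniteIntegralLevel n K), 0 < n → Summit.Langlands.Langlands.Theorems.CoreAdequacy.LiftBelow n → ∀ (ℓ : ℕ) [Fact ℓ.Prime] (ι : PadicAlgCl ℓ ≃+* ℂ) (ρ : Literature.NumberTheory.GaloisRepresentations.FramedGaloisRep K (PadicAlgCl ℓ) n), ℓ < 2 * (n + 1) → ℓ ≠ 2 → Summit.Langlands.Langlands.Theorems.CoreAdequacy.CycIrr ρ → ¬ Summit.Langlands.Langlands.Theorems.CoreAdequacy.AdequateCyclotomicImage ρ → ¬ Summit.Langlands.Langlands.Theorems.CoreAdequacy.SolvablyAdequateImage ρ → ¬ Summit.Langlands.Langlands.Theorems.CoreAdequacy.LieDefect.SolvableDescentShadow ρ → ¬ Summit.Langlands.Langlands.Theorems.CoreAdequacy.LieDefect.SolvablyQuasiAdequateImage ρ → ℓ ≤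 n → ¬ (∃ τ : Field.absoluteGaloisGroup (CyclotomicField ℓ K) →* Matrix.GeneralLinearGroup (Fin n) (Literature.NumberTheory.GaloisRepresentations.padicAlgClResidueField ℓ), (ρ.restrictField (CyclotomicField ℓ K)).IsReductionOf (RingHom.id (Literature.NumberTheory.GaloisRepresentations.padicAlgClResidueField ℓ)) τ ∧ Literature.NumberTheory.GaloisRepresentations.IsAbsIrreducible τ ∧ ∃ J : Subgroup (Matrix.GeneralLinearGroup (Fin n) (Literature.NumberTheory.GaloisRepresentations.padicAlgClResidueField ℓ)), Summit.Langlands.Langlands.Theorems.CoreAdequacy.LieDefect.AboveCore τ.range J ∧ J ≤ τ.range ∧ Literature.NumberTheory.GaloisRepresentations.IsAbsIrreducible J.subtype ∧ Literature.NumberTheory.GaloisRepresentations.Subgroup.IsExtendedAdequate J) → (∃ τ : Field.absoluteGaloisGroup (CyclotomicField ℓ K) →* Matrix.GeneralLinearGroup (Fin n) (Literature.NumberTheory.GaloisRepresentations.padicAlgClResidueField ℓ), (ρ.restrictField (CyclotomicField ℓ K)).IsReductionOf (RingHom.id (Literature.NumberTheory.GaloisRepresentations.padicAlgClResidueField ℓ))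 τ ∧ Literature.NumberTheory.GaloisRepresentations.IsAbsIrreducible τ ∧ Literature.NumberTheory.GaloisRepresentations.IsAbsIrreducible (Summit.Langlands.Langlands.Theorems.CoreAdequacy.perfectCore τ.range).subtype) → ¬ (∃ (E : Type) (_ : Field E) (_ : NumberField E) (_ : Algebra K E), IsGalois K E ∧ IsSolvable (E ≃ₐ[K] E) ∧ ((∃ (σ : Literature.NumberTheory.GaloisRepresentations.FramedGaloisRep E (PadicAlgCl ℓ) 2) (χ : Literature.NumberTheory.GaloisRepresentations.FramedGaloisRep E (PadicAlgCl ℓ) 1), σ.toGaloisRep.IsIrreducible ∧ Summit.Langlands.Langlands.Theorems.CoreAdequacy.LieDefect.Geometric σ ∧ Summit.Langlands.Langlands.Theorems.CoreAdequacy.LieDefect.Geometric χ ∧ ∀ g : Field.absoluteGaloisGroup E, 2 * Literature.NumberTheory.GaloisRepresentations.FramedRep.trace (ρ.restrictField E) g = Literature.NumberTheory.GaloisRepresentations.FramedRep.trace χ g * (Literature.NumberTheory.GaloisRepresentations.FramedRep.trace σ g ^ 2 + Literature.NumberTheory.GaloisRepresentations.FramedRep.trace σ (g * g))) ∨ (∃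 σ₁ σ₂ : Literature.NumberTheory.GaloisRepresentations.FramedGaloisRep E (PadicAlgCl ℓ) 2, σ₁.toGaloisRep.IsIrreducible ∧ σ₂.toGaloisRep.IsIrreducible ∧ Summit.Langlands.Langlands.Theorems.CoreAdequacy.LieDefect.Geometric σ₁ ∧ Summit.Langlands.Langlands.Theorems.CoreAdequacy.LieDefect.Geometric σ₂ ∧ ∀ g : Field.absoluteGaloisGroup E, Literature.NumberTheory.GaloisRepresentations.FramedRep.trace (ρ.restrictField E) g = Literature.NumberTheory.GaloisRepresentations.FramedRep.trace σ₁ g * Literature.NumberTheory.GaloisRepresentations.FramedRep.trace σ₂ g))) → (∃ τ : Field.absoluteGaloisGroup (CyclotomicField ℓ K) →* Matrix.GeneralLinearGroup (Fin n) (Literature.NumberTheory.GaloisRepresentations.padicAlgClResidueField ℓ), (ρ.restrictField (CyclotomicField ℓ K)).IsReductionOf (RingHom.id (Literature.NumberTheory.GaloisRepresentations.padicAlgClResidueField ℓ)) τ ∧ Literature.NumberTheory.GaloisRepresentations.IsAbsIrreducible τ ∧ ∃ J : Subgroup (Matrix.GeneralLinearGroup (Fin n) (Literature.NumberTheory.GaloisRepresentations.padicAlgClResidueField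 ℓ)), Summit.Langlands.Langlands.Theorems.CoreAdequacy.LieDefect.AboveCore τ.range J ∧ J ≤ τ.range ∧ Literature.NumberTheory.GaloisRepresentations.IsAbsIrreducible J.subtype ∧ (∀ f : Additive J →+ Literature.NumberTheory.GaloisRepresentations.padicAlgClResidueField ℓ, f = 0) ∧ groupCohomology.cocycles₁ (Rep.of (Literature.NumberTheory.GaloisRepresentations.Subgroup.adRep J)) ≤ groupCohomology.coboundaries₁ (Rep.of (Literature.NumberTheory.GaloisRepresentations.Subgroup.adRep J)) ∧ Literature.NumberTheory.GaloisRepresentations.Subgroup.semisimpleSpan J = ⊤) → ¬ Summit.Langlands.Langlands.Theorems.BrightMate.SolvablyReducible ρ → ¬ Summit.Langlands.Langlands.Theorems.BrightMate.SolvablyMated ι ρ → Summit.Langlands.Langlands.Theorems.CoreAdequacy.LiftTail K n hcpt ℓ ι ρ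

/-- Route item T⁺ (support 9) verbatim, fully qualified, no `open`. -/
def NearlyAdequateOrdinaryMinimalLifting : Prop :=
  ∀ (𝓐 : ∀ (K : Type) [Field K] [NumberField K] (v : IsDedekindDomain.HeightOneSpectrum (NumberField.RingOfIntegers K)), Literature.NumberTheory.GaloisRepresentations.LocalArtinData (v.adicCompletion K)), (∀ (K : Type) [Field K] [NumberField K] (v : IsDedekindDomain.HeightOneSpectrum (NumberField.RingOfIntegers K)), (𝓐 K v).IsCanonical) → ∀ (F : Type) [Field F] [NumberField F] [NumberField.IsCMField F] (n : ℕ), 2 ≤ n → ∀ (p : ℕ) [Fact p.Prime], ¬ (p = 2 ∧ Even n) → ∀ (hcpt : Literature.NumberTheory.Automorphic.isCompact_glFiniteIntegralLevel n F) (ι : PadicAlgCl p ≃+* ℂ) (ρ : Literature.NumberTheory.GaloisRepresentations.FramedGaloisRep F (PadicAlgCl p) n) (τ : Field.absoluteGaloisGroup F →* Matrix.GeneralLinearGroup (Fin n) (Literature.NumberTheory.GaloisRepresentations.padicAlgClResidueField p)) (π : Literature.NumberTheory.Automorphic.CuspidalAutomorphicRepData n F hcpt) (r : Literature.NumberTheory.GaloisRepresentations.FramedGaloisRep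 F (PadicAlgCl p) n) (c : Field.absoluteGaloisGroup (NumberField.maximalRealSubfield F)), Literature.NumberTheory.GaloisRepresentations.absGaloisQuot (NumberField.maximalRealSubfield F) F c = NumberField.IsCMField.complexConj F → (∀ σ : Field.absoluteGaloisGroup F, ((Literature.NumberTheory.GaloisRepresentations.FramedGaloisRep.outerConj c ρ) σ).val.trace = ((Units.map (algebraMap ℤ_[p] (PadicAlgCl p)).toMonoidHom (Literature.NumberTheory.GaloisRepresentations.GaloisRep.cyclotomicCharacter F p σ) ^ (1 - (n : ℤ)) : (PadicAlgCl p)ˣ) : PadicAlgCl p) * (ρ σ⁻¹).val.trace) → ρ.IsResidualRepOf (RingHom.id (Literature.NumberTheory.GaloisRepresentations.padicAlgClResidueField p)) τ → ((∀ f : Additive ((Literature.NumberTheory.GaloisRepresentations.absGaloisGroupAdjoinRootsOfUnity F p).map τ) →+ Literature.NumberTheory.GaloisRepresentations.padicAlgClResidueField p, f = 0) ∧ groupCohomology.cocycles₁ (Rep.of (Literature.NumberTheory.GaloisRepresentations.Subgroup.adRep ((Literature.NumberTheory.GaloisRepresentations.absGaloisGroupAdjoinRootsOfUnity F p).map τ)))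 ≤ groupCohomology.coboundaries₁ (Rep.of (Literature.NumberTheory.GaloisRepresentations.Subgroup.adRep ((Literature.NumberTheory.GaloisRepresentations.absGaloisGroupAdjoinRootsOfUnity F p).map τ))) ∧ Literature.NumberTheory.GaloisRepresentations.Subgroup.semisimpleSpan ((Literature.NumberTheory.GaloisRepresentations.absGaloisGroupAdjoinRootsOfUnity F p).map τ) = ⊤) → (∀ᶠ v : IsDedekindDomain.HeightOneSpectrum (NumberField.RingOfIntegers F) in Filter.cofinite, ρ.IsUnramifiedAt v) → π.1.IsRegularAlgebraic → π.1.IsEssConjSelfDual 1 → Literature.NumberTheory.Automorphic.HarrisLanTaylorThorne2016.IsCompatible π.1 ι r → r.IsResidualRepOf (RingHom.id (Literature.NumberTheory.GaloisRepresentations.padicAlgClResidueField p)) τ → (∀ v : IsDedekindDomain.HeightOneSpectrum (NumberField.RingOfIntegers F), ((p : ℕ) : NumberField.RingOfIntegers F) ∉ v.asIdeal → π.1.IsUnramifiedAt v ∧ ρ.IsUnramifiedAt v ∧ r.IsUnramifiedAt v) → (∀ (v : IsDedekindDomain.HeightOneSpectrum (NumberField.RingOfIntegers F)) (hv : ((p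 : ℕ) : NumberField.RingOfIntegers F) ∈ v.asIdeal), (Literature.NumberTheory.PAdicHodge.fontainePstAdicCompletion v p hv).IsCrystallineFramed (ρ.toLocal v) ∧ (Literature.NumberTheory.PAdicHodge.fontainePstAdicCompletion v p hv).IsCrystallineFramed (r.toLocal v) ∧ ∃ wt : Literature.NumberTheory.GaloisRepresentations.LabelledWeight (v.adicCompletion F) (PadicAlgCl p) n, ρ.IsOrdinaryOfLabelledWeightAt v (𝓐 F v) wt ∧ r.IsOrdinaryOfLabelledWeightAt v (𝓐 F v) wt) → Literature.NumberTheory.Automorphic.Qian2022.IsAutomorphic ι ρ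

/-- Route item Assembly (rank 1) verbatim. -/
def Assembly : Prop :=
  DyadicSchurLayerLifting → OddSchurLayerLifting → Summit.Langlands.Langlands.Theses.SchurDefectSplit.SchurDefectLayerLifting

/-- inline D ⟺ structured D. [bookkeeping] -/
theorem d_inline_iff : DyadicSchurLayerLifting ↔ CoreAdequacy.ExtAdequacy.SchurParity.DyadicSchurLayerLifting := Iff.rfl

/-- inline O ⟺ structured O. [bookkeeping] -/
theorem o_inline_iff : OddSchurLayerLifting ↔ CoreAdequacy.ExtAdequacy.SchurParity.OddSchurLayerLifting := Iff.rfl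

/-- inline T⁺ ⟺ structured T⁺. [bookkeeping] -/
theorem tplus_inline_iff : NearlyAdequateOrdinaryMinimalLifting ↔ CoreAdequacy.ExtAdequacy.SchurParity.NearlyAdequateOrdinaryMinimalLifting := Iff.rfl

/-- `closes` on the inline items (= kit `vr.glue.lean` verbatim): D → O → SCH BY NAME. -/
theorem closes (hD : DyadicSchurLayerLifting) (hO : OddSchurLayerLifting) :
    Summit.Langlands.Langlands.Theses.SchurDefectSplit.SchurDefectLayerLifting := by
  intro K _ _ n hcpt hn ih ℓ _ ι ρ hlt
  by_cases h2 : ℓ = 2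
  · exact hD K n hcpt hn ih ℓ ι ρ hlt h2
  · exact hO K n hcpt hn ih ℓ ι ρ hlt h2

/-- The Assembly item holds outright (it is the curried `closes`). -/
theorem assembly_holds : Assembly := closes

end Summit.Langlands.Langlands.Theorems.SchurParityInline
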